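import Summits.Schanuel.Schanuel.Theorems.RootDecomp1BExplicitPair02

/-!
# RootDecomp1BExplicitPair — lens 4, generation 44 «EXPLICIT JU PAIR (ρ_J, σ_J) BY A MEASURE-FREE INDEPENDENCE CRITERION» (CLAIM L2220, ACK/CHECKLIST B-g44 L2225, NODE L2248 / REQUEST L2249, writer re-check L2254, critic VERDICT L2251: CLEARED — THEOREM ×1 «measure-free nested-approximation independence criterion + first explicit JU member»; RULE B-R30; lens-4 tally THEOREM ×8 + CELL ×4) — continuation (RootDecomp1BExplicitPair03): §3 the explicit pair (ρ_J, σ_J) ∈ JU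

(lens-4 g44 HOME kernel K = HOME/decomp-schanuel-lens-4/g44/ExplicitPair.lean c215aab4…, 1070 l, import tree `…RootDecomp1BFactDischarge01` ONLY; P ExplicitPairProbe.lean 61d4e775… rc 0, C ExplicitPairCtrl.lean ef32d495… rc 1 = exactly the 12 planted errors. Port by census-1 gen 19 as `RootDecomp1BExplicitPair01`–`04` (after TwoStorey01–04, as sequenced): 01 = K doc + §1 the ONE new estimate «lower bound near a rational» (`shiftCoeff`, `qpow_mul_aeval_eq`, `exists_shiftCoeff_ne_zero`, `abs_shiftCoeff_le`, `lowest_term_dominates`, `eval_lower_near_rat`); 02 = §2 THE CRITERION (`NestedLiouville`, `algebraicIndependent_of_nestedLiouville`, sequence form `algebraicIndependent_of_dominated_approx`, the checklist's weighted shape `…_weighted`); 03 = §3 THE EXPLICIT PAIR (`rhoJ`/`sigmaJ` = even/odd sub-series of the tree tower `uTow`, `rhoJ_add_sigmaJ : rhoJ + sigmaJ = rhoU`, `nestedLiouville_rhoJ_sigmaJ`, `algebraicIndependent_rhoJ_sigmaJ`, `dominated_approx_rhoJ_sigmaJ`, `jointlyUltra_rhoJ_sigmaJ`, `JU_rhoJ_sigmaJ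 : JU rhoJ sigmaJ` against the TREE class, `exists_JU_explicit`); 04 = §4 each coordinate ultra-Liouville (tree `UltraLiouville`) ⟹ storey-two cells at `(1, ρ_J)`, `(1, σ_J)` BY NAME + §5 controls proved (`not_nestedLiouville_self`, `not_nestedLiouville_sq`, `frozen_level_insufficient`).
PORT EDITS: `import …RootDecomp1BTwoStorey04` added and K's LOCAL COPIES of `UltraLiouville₂`, `JU` (§3.6) and of g43's `not_algebraicIndependent_sq` DELETED — the tree decls of `RootDecomp1BTwoStorey02/04` are used BY NAME (verdict condition); the file-wide linter option dropped; 23 one-line docstrings added to §3 helper lemmas; 8 generic helpers made PRIVATE (dedup-safety: `aeval_ofReal_int` has name-and-statement twins in RadixCell04 / AlgFrame01; `sum_abs_coeff_eq_len`, `mul_pow_le_of_lt_inv_pow`, `lt_two_pow_of_le_nat`, `half_pow_mul_two_lt`, `threshold_mono`, `den_eq_of_odd`, `not_algebraicIndependent_self`) with per-part private copies; `variable {ρ σ : ℝ}` (implicit binders only) kept; graded statements and proofs verbatim. `--supports stmt-Schanuel-24622`; no census credit carried; rung 0 — nothing here proves Schanuel; `KleinPolarSchanuel`, t(1,ρ_J)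 ≥ 5 NOT derived.)
-/

noncomputable section

open Complex Filter Polynomial Finset

namespace Summit.Schanuel.Schanuel.Theorems.RootDecomp1BExplicitPair

open Summit.Schanuel.Schanuel.Theorems.RootDecomp1BTwoStorey (UltraLiouville₂ JU not_algebraicIndependent_sq)

open Summit.Schanuel.Schanuel.Theorems.RootDecomp1KHyper (len len_nonneg len_le_of_natDegree_le one_le_len
  abs_coeff_le_len exists_int_relation exists_ball_eval_ne_zero exists_lipschitz_at_root specialise
  aeval_specialise natDegree_specialise_le len_specialise_le transcendental_ofReal_of_liouville)

/-! ## §3  THE EXPLICIT PAIR `ρ_J = Σ_k 2^{-u(2k)}`, `σ_J = Σ_k 2^{-u(2k+1)}` (`u` = the tower `uTow` of the named member `ρ_U`) -/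

section ExplicitPair
open Summit.Schanuel.Schanuel.Theorems.RootDecomp1BRadicalDescent (uTow uTow_succ uTow_lt_succ uTow_strictMono
  le_uTow uTerm uTerm_pos summable_uTerm rhoU summable_uTerm_shift tail_le tail_lt_threshold)

/-! ### §3.1 growth of the tower -/

/-- Linear growth of the tower: `4 (K+1) u_K + 4 ≤ u_{K+1}` (`u_{K+1} = 4 · 3^{3^{(K+1) u_K}}`). -/
theorem four_mul_uTow_le_succ (K : ℕ) : 4 * (K + 1) * uTow K + 4 ≤ uTow (K + 1) := by
  rw [uTow_succ]
  have h1 : (K + 1) * uTow K < 3 ^ ((K + 1) * uTow K) := Nat.lt_pow_self (by norm_num)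
  have h2 : 3 ^ ((K + 1) * uTow K) < 3 ^ (3 ^ ((K + 1) * uTow K)) :=
    Nat.pow_lt_pow_right (by norm_num) h1
  have h3 : 4 * (K + 1) * uTow K = 4 * ((K + 1) * uTow K) := by ring
  omega

/-- `k · u_K + 2 ≤ u_{K+1}` as soon as `k ≤ 4 (K + 1)`. -/
theorem mul_uTow_add_two_le {k K : ℕ} (hk : k ≤ 4 * (K + 1)) : k * uTow K + 2 ≤ uTow (K + 1) := by
  have h1 : k * uTow K ≤ 4 * (K + 1) * uTow K := Nat.mul_le_mul_right (uTow K) hk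
  have h2 := four_mul_uTow_le_succ K
  omega

/-- `1 ≤ u_K`. -/
theorem one_le_uTow (K : ℕ) : 1 ≤ uTow K := by
  have h := uTow_strictMono.monotone (Nat.zero_le K)
  simpa using h

/-- `2 ≤ 2^{u_K}`. -/
theorem two_le_two_pow_uTow (K : ℕ) : 2 ≤ 2 ^ uTow K :=
  calc 2 = 2 ^ 1 := rfl
    _ ≤ 2 ^ uTow K := Nat.pow_le_pow_right two_pos (one_le_uTow K)

/-- `(1/2)^m · 2 < (1/2)^n` when `n + 2 ≤ m`. -/
private theorem half_pow_mul_two_lt {m n : ℕ} (h : n + 2 ≤ m) :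
    ((1 : ℝ) / 2) ^ m * 2 < ((1 : ℝ) / 2) ^ n := by
  have h1 : ((1 : ℝ) / 2) ^ m ≤ ((1 : ℝ) / 2) ^ (n + 2) :=
    pow_le_pow_of_le_one (by norm_num) (by norm_num) h
  have h2 : ((1 : ℝ) / 2) ^ (n + 2) * 2 = ((1 : ℝ) / 2) ^ n / 2 := by rw [pow_add]; ring
  have h3 : (0 : ℝ) < ((1 : ℝ) / 2) ^ n := by positivity
  nlinarith

/-! ### §3.2 the even / odd sub-series -/

/-- the even-indexed tower terms `2^{-u_j}` (`j` even), `0` otherwise -/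
def eTerm (j : ℕ) : ℝ := if Even j then uTerm j else 0

/-- the odd-indexed tower terms `2^{-u_j}` (`j` odd), `0` otherwise -/
def oTerm (j : ℕ) : ℝ := if Even j then 0 else uTerm j

/-- `eTerm j + oTerm j = uTerm j`. -/
theorem eTerm_add_oTerm (j : ℕ) : eTerm j + oTerm j = uTerm j := by
  unfold eTerm oTerm; split_ifs <;> simp

/-- `0 ≤ eTerm j`. -/
theorem eTerm_nonneg (j : ℕ) : 0 ≤ eTerm j := by
  unfold eTerm; split_ifs; exacts [(uTerm_pos j).le, le_rfl]

/-- `0 ≤ oTerm j`. -/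
theorem oTerm_nonneg (j : ℕ) : 0 ≤ oTerm j := by
  unfold oTerm; split_ifs; exacts [le_rfl, (uTerm_pos j).le]

/-- `eTerm j ≤ uTerm j`. -/
theorem eTerm_le (j : ℕ) : eTerm j ≤ uTerm j := by
  unfold eTerm; split_ifs; exacts [le_rfl, (uTerm_pos j).le]

/-- `oTerm j ≤ uTerm j`. -/
theorem oTerm_le (j : ℕ) : oTerm j ≤ uTerm j := by
  unfold oTerm; split_ifs; exacts [(uTerm_pos j).le, le_rfl]

/-- At even `j`, `eTerm j = uTerm j`. -/
theorem eTerm_of_even {j : ℕ} (h : Even j) : eTerm j = uTerm j := by simp [eTerm, h]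

/-- At even `j`, `oTerm j = 0`. -/
theorem oTerm_of_even {j : ℕ} (h : Even j) : oTerm j = 0 := by simp [oTerm, h]

/-- At odd `j`, `oTerm j = uTerm j`. -/
theorem oTerm_of_odd {j : ℕ} (h : ¬ Even j) : oTerm j = uTerm j := by simp [oTerm, h]

/-- The even sub-series is summable. -/
theorem summable_eTerm : Summable eTerm :=
  Summable.of_nonneg_of_le eTerm_nonneg eTerm_le summable_uTerm

/-- The odd sub-series is summable. -/
theorem summable_oTerm : Summable oTerm :=
  Summable.of_nonneg_of_le oTerm_nonneg oTerm_le summable_uTerm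

/-- Shifted even sub-series summable. -/
theorem summable_eTerm_shift (N : ℕ) : Summable fun j => eTerm (j + N) :=
  (summable_nat_add_iff N).mpr summable_eTerm

/-- Shifted odd sub-series summable. -/
theorem summable_oTerm_shift (N : ℕ) : Summable fun j => oTerm (j + N) :=
  (summable_nat_add_iff N).mpr summable_oTerm

/-- **`ρ_J := Σ_k 2^{-u_{2k}}`** — the even half of the tower number `ρ_U`. -/
def rhoJ : ℝ := ∑' j, eTerm j

/-- **`σ_J := Σ_k 2^{-u_{2k+1}}`** — the odd half of the tower number `ρ_U`. -/
def sigmaJ : ℝ := ∑' j, oTerm j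

/-- `ρ_J + σ_J = ρ_U`. -/
theorem rhoJ_add_sigmaJ : rhoJ + sigmaJ = rhoU := by
  rw [rhoJ, sigmaJ, ← summable_eTerm.tsum_add summable_oTerm]
  exact tsum_congr eTerm_add_oTerm

/-- `ρ_J > 0`. -/
theorem rhoJ_pos : 0 < rhoJ :=
  summable_eTerm.tsum_pos eTerm_nonneg 0 (by rw [eTerm_of_even (by decide)]; exact uTerm_pos 0)

/-- `σ_J > 0`. -/
theorem sigmaJ_pos : 0 < sigmaJ :=
  summable_oTerm.tsum_pos oTerm_nonneg 1 (by rw [oTerm_of_odd (by decide)]; exact uTerm_pos 1)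

/-! ### §3.3 partial sums on the common denominator `2^{u_K}` and tails -/

/-- numerator of the `K`-th partial sum of `ρ_J`: `A_K = Σ_{j ≤ K, j even} 2^{u_K − u_j}` -/
def eNum (K : ℕ) : ℕ := ∑ j ∈ range (K + 1), if Even j then 2 ^ (uTow K - uTow j) else 0

/-- numerator of the `K`-th partial sum of `σ_J`: `B_K = Σ_{j ≤ K, j odd} 2^{u_K − u_j}` -/
def oNum (K : ℕ) : ℕ := ∑ j ∈ range (K + 1), if Even j then 0 else 2 ^ (uTow K - uTow j)

/-- Partial sums of the even sub-series on the common denominator `2^{u_K}`. -/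
theorem sum_eTerm_eq (K : ℕ) : ∑ j ∈ range (K + 1), eTerm j = (eNum K : ℝ) / 2 ^ uTow K := by
  unfold eNum eTerm uTerm
  push_cast
  rw [Finset.sum_div]
  refine Finset.sum_congr rfl fun j hj => ?_
  have hj' : uTow j ≤ uTow K := uTow_strictMono.monotone (Nat.lt_succ_iff.mp (mem_range.mp hj))
  split_ifs
  · rw [one_div_pow, pow_sub₀ (2 : ℝ) two_ne_zero hj']
    field_simp
  · simp

/-- Partial sums of the odd sub-series on the common denominator `2^{u_K}`. -/
theorem sum_oTerm_eq (K : ℕ) : ∑ j ∈ range (K + 1), oTerm j = (oNum K : ℝ) / 2 ^ uTow K := by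
  unfold oNum oTerm uTerm
  push_cast
  rw [Finset.sum_div]
  refine Finset.sum_congr rfl fun j hj => ?_
  have hj' : uTow j ≤ uTow K := uTow_strictMono.monotone (Nat.lt_succ_iff.mp (mem_range.mp hj))
  split_ifs
  · simp
  · rw [one_div_pow, pow_sub₀ (2 : ℝ) two_ne_zero hj']
    field_simp

/-- the error of the `K`-th approximation of `ρ_J` is the even tail -/
theorem rhoJ_sub (K : ℕ) : rhoJ - (eNum K : ℝ) / 2 ^ uTow K = ∑' j, eTerm (j + (K + 1)) := by
  rw [← sum_eTerm_eq, rhoJ, ← summable_eTerm.sum_add_tsum_nat_add (K + 1)]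
  ring

/-- the error of the `K`-th approximation of `σ_J` is the odd tail -/
theorem sigmaJ_sub (K : ℕ) : sigmaJ - (oNum K : ℝ) / 2 ^ uTow K = ∑' j, oTerm (j + (K + 1)) := by
  rw [← sum_oTerm_eq, sigmaJ, ← summable_oTerm.sum_add_tsum_nat_add (K + 1)]
  ring

/-- The even tail is positive. -/
theorem eTail_pos (K : ℕ) : 0 < ∑' j, eTerm (j + (K + 1)) := by
  rcases Nat.even_or_odd (K + 1) with h | h
  · exact (summable_eTerm_shift _).tsum_pos (fun _ => eTerm_nonneg _) 0
      (by rw [zero_add, eTerm_of_even h]; exact uTerm_pos _)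
  · refine (summable_eTerm_shift _).tsum_pos (fun _ => eTerm_nonneg _) 1 ?_
    have h' : Even (1 + (K + 1)) := by rw [add_comm]; exact h.add_one
    rw [eTerm_of_even h']; exact uTerm_pos _

/-- The odd tail is positive. -/
theorem oTail_pos (K : ℕ) : 0 < ∑' j, oTerm (j + (K + 1)) := by
  rcases Nat.even_or_odd (K + 1) with h | h
  · refine (summable_oTerm_shift _).tsum_pos (fun _ => oTerm_nonneg _) 1 ?_
    have h' : ¬ Even (1 + (K + 1)) := by
      rw [add_comm, Nat.not_even_iff_odd]; exact h.add_one
    rw [oTerm_of_odd h']; exact uTerm_pos _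
  · exact (summable_oTerm_shift _).tsum_pos (fun _ => oTerm_nonneg _) 0
      (by rw [zero_add, oTerm_of_odd (Nat.not_even_iff_odd.mpr h)]; exact uTerm_pos _)

/-- Even tail bound `≤ 2·2^{−u_{K+1}}`. -/
theorem eTail_le (K : ℕ) : ∑' j, eTerm (j + (K + 1)) ≤ ((1 : ℝ) / 2) ^ uTow (K + 1) * 2 :=
  ((summable_eTerm_shift _).tsum_le_tsum (fun _ => eTerm_le _) (summable_uTerm_shift K)).trans (tail_le K)

/-- Odd tail bound `≤ 2·2^{−u_{K+1}}`. -/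
theorem oTail_le (K : ℕ) : ∑' j, oTerm (j + (K + 1)) ≤ ((1 : ℝ) / 2) ^ uTow (K + 1) * 2 :=
  ((summable_oTerm_shift _).tsum_le_tsum (fun _ => oTerm_le _) (summable_uTerm_shift K)).trans (tail_le K)

/-- at an ODD level `K` the even tail starts with the full term `2^{-u_{K+1}}` -/
theorem le_eTail_of_even {K : ℕ} (hK : Even (K + 1)) :
    ((1 : ℝ) / 2) ^ uTow (K + 1) ≤ ∑' j, eTerm (j + (K + 1)) := by
  rw [(summable_eTerm_shift (K + 1)).tsum_eq_zero_add, zero_add, eTerm_of_even hK]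
  have h0 : 0 ≤ ∑' j, eTerm (j + 1 + (K + 1)) := tsum_nonneg fun _ => eTerm_nonneg _
  unfold uTerm
  linarith

/-- at an ODD level `K` the odd tail skips the index `K + 1`: it is at most `2 · 2^{-u_{K+2}}` -/
theorem oTail_le_of_even {K : ℕ} (hK : Even (K + 1)) :
    ∑' j, oTerm (j + (K + 1)) ≤ ((1 : ℝ) / 2) ^ uTow (K + 2) * 2 := by
  rw [(summable_oTerm_shift (K + 1)).tsum_eq_zero_add, zero_add, oTerm_of_even hK, zero_add]
  have h1 : (fun j => oTerm (j + 1 + (K + 1))) = fun j => oTerm (j + (K + 1 + 1)) := by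
    funext j; ring_nf
  rw [h1]
  exact oTail_le (K + 1)

/-! ### §3.4 the pair is nested-Liouville (odd levels `K = 2k+1`, `q = 2^{u_K}`), hence algebraically independent -/

/-- the approximation data at level `K`, in the shape of `NestedLiouville` / `UltraLiouville₂` -/
theorem approx_data (K : ℕ) :
    rhoJ - (((eNum K : ℕ) : ℤ) : ℝ) / ((2 ^ uTow K : ℕ) : ℝ) = ∑' j, eTerm (j + (K + 1)) ∧
    sigmaJ - (((oNum K : ℕ) : ℤ) : ℝ) / ((2 ^ uTow K : ℕ) : ℝ) = ∑' j, oTerm (j + (K + 1)) := by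
  constructor
  · rw [← rhoJ_sub K]; push_cast; rfl
  · rw [← sigmaJ_sub K]; push_cast; rfl

/-- **the level-`K` bounds** (`K + 1` even, `k ≤ 4(K+1)`; `q = 2^{u_K}`, `A = A_K = eNum K`, `B = B_K = oNum K`):
`ρ_J ≠ A/q`, `σ_J ≠ B/q`, `|ρ_J − A/q| < q^{-k}`, `|σ_J − B/q| < |ρ_J − A/q|^k` — from the two-sided tail bounds
`2^{-u_{K+1}} ≤ ρ_J − A/q ≤ 2·2^{-u_{K+1}}`, `0 < σ_J − B/q ≤ 2·2^{-u_{K+2}}` and the growth `k·u_K + 2 ≤ u_{K+1}`,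
`k·u_{K+1} + 2 ≤ u_{K+2}` of the tower (`mul_uTow_add_two_le`). -/
theorem level_bounds {k K : ℕ} (hKe : Even (K + 1)) (hk : k ≤ 4 * (K + 1)) :
    rhoJ ≠ (((eNum K : ℕ) : ℤ) : ℝ) / ((2 ^ uTow K : ℕ) : ℝ) ∧
    sigmaJ ≠ (((oNum K : ℕ) : ℤ) : ℝ) / ((2 ^ uTow K : ℕ) : ℝ) ∧
    |rhoJ - (((eNum K : ℕ) : ℤ) : ℝ) / ((2 ^ uTow K : ℕ) : ℝ)| < 1 / (((2 ^ uTow K : ℕ) : ℝ)) ^ k ∧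
    |sigmaJ - (((oNum K : ℕ) : ℤ) : ℝ) / ((2 ^ uTow K : ℕ) : ℝ)| <
      |rhoJ - (((eNum K : ℕ) : ℤ) : ℝ) / ((2 ^ uTow K : ℕ) : ℝ)| ^ k := by
  obtain ⟨hρ, hσ⟩ := approx_data K
  refine ⟨?_, ?_, ?_, ?_⟩
  · intro h
    have := eTail_pos K
    rw [← hρ, h, sub_self] at this
    exact lt_irrefl _ this
  · intro h
    have := oTail_pos K
    rw [← hσ, h, sub_self] at this
    exact lt_irrefl _ this
  · rw [hρ, abs_of_pos (eTail_pos K)]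
    have hq : ((2 ^ uTow K : ℕ) : ℝ) ^ k = (2 : ℝ) ^ (k * uTow K) := by
      push_cast; rw [← pow_mul, mul_comm]
    rw [hq, ← one_div_pow]
    exact (eTail_le K).trans_lt (half_pow_mul_two_lt (mul_uTow_add_two_le hk))
  · rw [hρ, hσ, abs_of_pos (eTail_pos K), abs_of_pos (oTail_pos K)]
    calc ∑' j, oTerm (j + (K + 1)) ≤ ((1 : ℝ) / 2) ^ uTow (K + 2) * 2 := oTail_le_of_even hKe
      _ < ((1 : ℝ) / 2) ^ (k * uTow (K + 1)) := half_pow_mul_two_lt (mul_uTow_add_two_le (by omega))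
      _ = (((1 : ℝ) / 2) ^ uTow (K + 1)) ^ k := by rw [← pow_mul, mul_comm]
      _ ≤ (∑' j, eTerm (j + (K + 1))) ^ k := pow_le_pow_left₀ (by positivity) (le_eTail_of_even hKe) k

/-- **`(ρ_J, σ_J)` IS A NESTED LIOUVILLE PAIR** (hypothesis-free): at the odd level `K = 2k+1`, with
`q = 2^{u_K}`, `0 < ρ_J − A_K/q ≤ 2·2^{-u_{K+1}} < q^{-k}` and `0 < σ_J − B_K/q ≤ 2·2^{-u_{K+2}} <
(2^{-u_{K+1}})^k ≤ (ρ_J − A_K/q)^k` (`level_bounds`). -/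
theorem nestedLiouville_rhoJ_sigmaJ : NestedLiouville rhoJ sigmaJ := fun k =>
  ⟨2 ^ uTow (2 * k + 1), eNum (2 * k + 1), oNum (2 * k + 1), two_le_two_pow_uTow _,
    level_bounds (k := k) (K := 2 * k + 1) ⟨k + 1, by ring⟩ (by omega)⟩

/-- **`ρ_J` and `σ_J` ARE ALGEBRAICALLY INDEPENDENT OVER `ℚ`** (hypothesis-free; axioms standard). -/
theorem algebraicIndependent_rhoJ_sigmaJ :
    AlgebraicIndependent ℚ ![(rhoJ : ℂ), (sigmaJ : ℂ)] :=
  algebraicIndependent_of_nestedLiouville nestedLiouville_rhoJ_sigmaJ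

/-- the EXPLICIT approximant schedule on the odd levels: `q_n = 2^{u_{2n+1}}` … -/
def qSeq (n : ℕ) : ℕ := 2 ^ uTow (2 * n + 1)

/-- … `a_n = A_{2n+1}` (`= 2^{u_{2n+1}} · Σ_{j ≤ n} 2^{-u_{2j}}`) … -/
def aSeq (n : ℕ) : ℤ := eNum (2 * n + 1)

/-- … `b_n = B_{2n+1}` (`= 2^{u_{2n+1}} · Σ_{j ≤ n} 2^{-u_{2j+1}}`). -/
def bSeq (n : ℕ) : ℤ := oNum (2 * n + 1)

/-- `2 ≤ qSeq n`. -/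
theorem two_le_qSeq (n : ℕ) : 2 ≤ qSeq n := two_le_two_pow_uTow _

/-- **THE INSTANTIATION LEMMA** (sequence shape): for every `k`, eventually — indeed for all `n ≥ k`, even for
all `n` with `k ≤ 8n + 8` — the schedule `(a_n, b_n; q_n)` is a nested approximation of `(ρ_J, σ_J)` of order `k`. -/
theorem dominated_approx_rhoJ_sigmaJ (k : ℕ) : ∀ᶠ n in atTop,
    rhoJ ≠ aSeq n / qSeq n ∧ sigmaJ ≠ bSeq n / qSeq n ∧
      |rhoJ - aSeq n / qSeq n| < 1 / (qSeq n : ℝ) ^ k ∧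
      |sigmaJ - bSeq n / qSeq n| < |rhoJ - aSeq n / qSeq n| ^ k :=
  Filter.eventually_atTop.2 ⟨k, fun n hn => level_bounds (k := k) (K := 2 * n + 1) ⟨n + 1, by ring⟩ (by omega)⟩

/-- the algebraic independence again, through the sequence form of the criterion and the explicit schedule -/
theorem algebraicIndependent_rhoJ_sigmaJ_seq :
    AlgebraicIndependent ℚ ![(rhoJ : ℂ), (sigmaJ : ℂ)] :=
  algebraicIndependent_of_dominated_approx aSeq bSeq qSeq two_le_qSeq dominated_approx_rhoJ_sigmaJ

/-! ### §3.5 the pair is jointly ultra-Liouville on the common denominators `2^{u_m}` -/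

/-- **`(ρ_J, σ_J)` IS JOINTLY ULTRA-LIOUVILLE** — the body of lens-4 g43 `UltraLiouville₂ ρ_J σ_J` verbatim:
at order `m`, `q = 2^{u_m} ≥ m`, `a = A_m`, `b = B_m`, both errors `≤ 2·2^{-u_{m+1}} < exp(−exp(q^m))`
(`tail_lt_threshold`, the growth inequality of the named member `ρ_U`). -/
theorem jointlyUltra_rhoJ_sigmaJ : ∀ m : ℕ, ∃ (q : ℕ) (a b : ℤ), m ≤ q ∧
    |rhoJ - (a : ℝ) / q| < Real.exp (-Real.exp ((q : ℝ) ^ m)) ∧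
    |sigmaJ - (b : ℝ) / q| < Real.exp (-Real.exp ((q : ℝ) ^ m)) := by
  intro m
  obtain ⟨hρ, hσ⟩ := approx_data m
  refine ⟨2 ^ uTow m, eNum m, oNum m, (le_uTow m).trans Nat.lt_two_pow_self.le, ?_, ?_⟩
  · rw [hρ, abs_of_pos (eTail_pos m)]
    exact (eTail_le m).trans_lt (tail_lt_threshold m)
  · rw [hσ, abs_of_pos (oTail_pos m)]
    exact (oTail_le m).trans_lt (tail_lt_threshold m)

/-- **THE EXPLICIT `JU` PAIR** — the four conjuncts of lens-4 g43 `JU ρ_J σ_J`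
(`JU ρ σ := 0 < ρ ∧ 0 < σ ∧ UltraLiouville₂ ρ σ ∧ AlgebraicIndependent ℚ ![(ρ:ℂ), (σ:ℂ)]`), stated against
tree names only (the g43 module `RootDecomp1BTwoStorey` is not yet in the tree; once it is, this theorem IS
`JU rhoJ sigmaJ` by `Iff.rfl`, and `six_le_polarDeg_one_pair` turns it into the explicit storey-three cell
`6 ≤ t(1, ρ_J, σ_J)`). Hypothesis-free. -/
theorem JU_rhoJ_sigmaJ_unfolded :
    0 < rhoJ ∧ 0 < sigmaJ ∧
    (∀ m : ℕ, ∃ (q : ℕ) (a b : ℤ), m ≤ q ∧ |rhoJ - (a : ℝ) / q| < Real.exp (-Real.exp ((q : ℝ) ^ m)) ∧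
      |sigmaJ - (b : ℝ) / q| < Real.exp (-Real.exp ((q : ℝ) ^ m))) ∧
    AlgebraicIndependent ℚ ![(rhoJ : ℂ), (sigmaJ : ℂ)] :=
  ⟨rhoJ_pos, sigmaJ_pos, jointlyUltra_rhoJ_sigmaJ, algebraicIndependent_rhoJ_sigmaJ⟩

/-! ### §3.6 the class `JU` of lens-4 g43 — the TREE definitions `RootDecomp1BTwoStorey.UltraLiouville₂` and
`RootDecomp1BTwoStorey.JU` (part `RootDecomp1BTwoStorey02`, census g19) BY NAME; K's local verbatim copies (CHECKLIST
B-g44 (3)) were deleted at port, as the verdict asked. -/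

/-- `(ρ_J, σ_J)` is jointly ultra-Liouville in g43's sense (definitional unfolding of `jointlyUltra_rhoJ_sigmaJ`). -/
theorem ultraLiouville₂_rhoJ_sigmaJ : UltraLiouville₂ rhoJ sigmaJ := jointlyUltra_rhoJ_sigmaJ

/-- **THE EXPLICIT MEMBER OF `JU`: `JU ρ_J σ_J`** — hypothesis-free, axioms standard.  The first EXPLICIT point
of g43's comeagre class `JU` (g43 §C has the Baire witness `exists_pos_pair` only); with g43's storey-three cell
`six_le_polarDeg_one_pair : JU ρ σ → 6 ≤ t(1, ρ, σ)` it is the explicit storey-three frame `(1, ρ_J, σ_J)`. -/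
theorem JU_rhoJ_sigmaJ : JU rhoJ sigmaJ := JU_rhoJ_sigmaJ_unfolded

/-- hence `JU` is non-empty WITH A NAMED WITNESS splitting the named member `ρ_U` (cf. g43 `exists_pos_pair`). -/
theorem exists_JU_explicit : ∃ ρ σ : ℝ, JU ρ σ ∧ ρ + σ = rhoU :=
  ⟨rhoJ, sigmaJ, JU_rhoJ_sigmaJ, rhoJ_add_sigmaJ⟩

end ExplicitPair

end Summit.Schanuel.Schanuel.Theorems.RootDecomp1BExplicitPair

end
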